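import Summits.Ventures.PercRepro.RankLevelSetDepCountHeavyCap

/-!
# PercRepro — THE BASIS DEVICE, PART A: THE GREEDY COUNT OF THE INDEPENDENT `q`-SUBSETS (p8 g10, S3)

`proofs/SUBCLAIM-S3-p8.md` §3x. A rank-`q` set `F` with `m` points, in a matroid whose sets of rank `≤ i < q` have at
most `f i` points, contains at least `∏_{i < q} max(m − f i, 1) / q!` independent `q`-subsets: an independent `i`-set
`I ⊆ F` extends by every `x ∈ F ∖ cl(I)` — at least `max(m − f i, 1)` choices, since `cl(I)` has rank `i` and
`F ⊄ cl(I)` (`card_extF_ge`) — and an independent `(i + 1)`-set arises from at most `i + 1` such pairs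
(`mul_card_indepF_succ_ge`); the product follows by induction (`factorial_mul_card_indepF_ge`). Part B
(RankLevelSetBasisDeviceB) turns this into the count of the rank-`q` sets by the flats they span. Axioms: standard.
-/

open scoped Matroid

namespace PercRepro

namespace Matroid

open Set Finset

variable {α : Type} {M : _root_.Matroid α}

open scoped Classical in
/-- The independent `i`-element subsets of a finset `F`. -/
noncomputable def indepF (M : _root_.Matroid α) (F : Finset α) (i : ℕ) : Finset (Finset α) :=
  (F.powersetCard i).filter (fun I => M.Indep (I : Set α))

open scoped Classical in
/-- Membership in `indepF`. -/
theorem mem_indepF {F I : Finset α} {i : ℕ} :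
    I ∈ indepF M F i ↔ I ⊆ F ∧ I.card = i ∧ M.Indep (I : Set α) := by
  unfold indepF
  rw [Finset.mem_filter, Finset.mem_powersetCard]
  tauto

open scoped Classical in
/-- The only independent `0`-subset is `∅`. -/
theorem card_indepF_zero (F : Finset α) : (indepF M F 0).card = 1 := by
  have h : indepF M F 0 = {∅} := by
    ext I
    rw [mem_indepF, Finset.mem_singleton, Finset.card_eq_zero]
    constructor
    · rintro ⟨-, h, -⟩; exact h
    · rintro rfl; exact ⟨Finset.empty_subset _, rfl, by simp⟩
  rw [h, Finset.card_singleton]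

open scoped Classical in
/-- `#indepF F i ≤ C(|F|, i)`. -/
theorem card_indepF_le_choose (F : Finset α) (i : ℕ) : (indepF M F i).card ≤ F.card.choose i := by
  unfold indepF
  exact (Finset.card_filter_le _ _).trans (Finset.card_powersetCard i F).le

open scoped Classical in
/-- The extension set of `I` inside `F`: the points of `F` outside `cl(I)`. -/
noncomputable def extF (M : _root_.Matroid α) (F I : Finset α) : Finset α :=
  F.filter (fun x => x ∉ M.closure (I : Set α))

open scoped Classical in
/-- **The greedy choices**: an independent `i`-set `I ⊆ F` (`i < q = r(F)`) has at least `max(|F| − f, 1)` extensions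
inside `F` when every set of rank `≤ i` has at most `f` points. -/
theorem card_extF_ge [M.Finite] (F I : Finset α) (hF : (F : Set α) ⊆ M.E) (q i : ℕ) (hi : i < q)
    (hFq : M.eRk (F : Set α) = q) (hI : I ∈ indepF M F i) (f : ℕ)
    (hf : ∀ X ⊆ M.E, M.eRk X ≤ i → X.ncard ≤ f) :
    max (F.card - f) 1 ≤ (extF M F I).card := by
  obtain ⟨hIF, hIc, hInd⟩ := mem_indepF.1 hI
  have hIE : (I : Set α) ⊆ M.E := (Finset.coe_subset.2 hIF).trans hF
  set X := M.closure (I : Set α) with hX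
  have hXE : X ⊆ M.E := M.closure_subset_ground _
  have hXr : M.eRk X ≤ i := by
    rw [hX, M.eRk_closure_eq, hInd.eRk_eq_encard, Set.encard_coe_eq_coe_finsetCard, hIc]
  have hXfin : X.Finite := M.ground_finite.subset hXE
  -- the points of `F` inside `cl(I)` number at most `f`
  have h1 : (F.filter (fun x => x ∈ X)).card ≤ f := by
    have hsub : ((F.filter (fun x => x ∈ X) : Finset α) : Set α) ⊆ X := by
      intro x hx
      rw [Finset.mem_coe, Finset.mem_filter] at hx
      exact hx.2
    have := Set.ncard_le_ncard hsub hXfin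
    rw [Set.ncard_coe_finset] at this
    exact this.trans (hf X hXE hXr)
  have h2 : (extF M F I).card + (F.filter (fun x => x ∈ X)).card = F.card := by
    unfold extF
    rw [add_comm]
    exact Finset.card_filter_add_card_filter_not (fun x => x ∈ X)
  -- at least one extension: `F ⊄ cl(I)` since `r(F) = q > i ≥ r(cl I)`
  have h3 : 1 ≤ (extF M F I).card := by
    by_contra hcon
    push Not at hcon
    have hempty : extF M F I = ∅ := Finset.card_eq_zero.1 (by omega)
    have hFX : (F : Set α) ⊆ X := by
      intro x hx
      by_contra hxX
      have hmem : x ∈ extF M F I := by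
        unfold extF
        rw [Finset.mem_filter]
        exact ⟨Finset.mem_coe.1 hx, hxX⟩
      rw [hempty] at hmem
      exact Finset.notMem_empty _ hmem
    have h4 : M.eRk (F : Set α) ≤ i := (M.eRk_mono hFX).trans hXr
    rw [hFq] at h4
    have h5 : q ≤ i := by exact_mod_cast h4
    omega
  exact max_le (by omega) h3

open scoped Classical in
/-- **The greedy step**: `#indepF F i · max(|F| − f, 1) ≤ (i + 1) · #indepF F (i + 1)`. -/
theorem mul_card_indepF_succ_ge [M.Finite] (F : Finset α) (hF : (F : Set α) ⊆ M.E) (q i : ℕ) (hi : i < q)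
    (hFq : M.eRk (F : Set α) = q) (f : ℕ) (hf : ∀ X ⊆ M.E, M.eRk X ≤ i → X.ncard ≤ f) :
    (indepF M F i).card * max (F.card - f) 1 ≤ (i + 1) * (indepF M F (i + 1)).card := by
  -- the pairs `(I, x)` with `I` an independent `i`-subset of `F` and `x ∈ F ∖ cl(I)`
  set S : Finset (Σ _ : Finset α, α) := (indepF M F i).sigma (fun I => extF M F I) with hS
  have hcardS : (indepF M F i).card * max (F.card - f) 1 ≤ S.card := by
    rw [hS, Finset.card_sigma]
    calc (indepF M F i).card * max (F.card - f) 1 = ∑ _I ∈ indepF M F i, max (F.card - f) 1 := by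
          rw [Finset.sum_const, smul_eq_mul]
      _ ≤ ∑ I ∈ indepF M F i, (extF M F I).card :=
          Finset.sum_le_sum (fun I hI => card_extF_ge F I hF q i hi hFq hI f hf)
  -- the map `(I, x) ↦ insert x I` lands in the independent `(i + 1)`-subsets
  have hmaps : ∀ z ∈ S, (insert z.2 z.1 : Finset α) ∈ indepF M F (i + 1) := by
    intro z hz
    rw [hS, Finset.mem_sigma] at hz
    obtain ⟨hz1, hz2⟩ := hz
    obtain ⟨hIF, hIc, hInd⟩ := mem_indepF.1 hz1
    unfold extF at hz2
    rw [Finset.mem_filter] at hz2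
    obtain ⟨hxF, hxcl⟩ := hz2
    have hIE : (z.1 : Set α) ⊆ M.E := (Finset.coe_subset.2 hIF).trans hF
    have hxI : z.2 ∉ z.1 := fun h => hxcl (M.subset_closure _ hIE (Finset.mem_coe.2 h))
    have hxE : z.2 ∈ M.E := hF (Finset.mem_coe.2 hxF)
    rw [mem_indepF]
    refine ⟨Finset.insert_subset hxF hIF, by rw [Finset.card_insert_of_notMem hxI, hIc], ?_⟩
    rw [Finset.coe_insert]
    exact (hInd.insert_indep_iff_of_notMem hxI).2 ⟨hxE, hxcl⟩
  -- each independent `(i + 1)`-set `J` arises from at most `i + 1` pairs (`x ∈ J` determines the pair)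
  have hfib : ∀ J ∈ indepF M F (i + 1), (S.filter (fun z => (insert z.2 z.1 : Finset α) = J)).card ≤ i + 1 := by
    intro J hJ
    obtain ⟨-, hJc, -⟩ := mem_indepF.1 hJ
    rw [← hJc]
    refine Finset.card_le_card_of_injOn (fun z => z.2) ?_ ?_
    · intro z hz
      rw [Finset.mem_coe, Finset.mem_filter] at hz
      rw [Finset.mem_coe, ← hz.2]
      exact Finset.mem_insert_self _ _
    · intro z hz z' hz' hzz'
      rw [Finset.mem_coe, Finset.mem_filter] at hz hz'
      have hxI : z.2 ∉ z.1 := by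
        have h := hz.1
        rw [hS, Finset.mem_sigma] at h
        have h2 := h.2
        unfold extF at h2
        rw [Finset.mem_filter] at h2
        obtain ⟨hIF, -, -⟩ := mem_indepF.1 h.1
        exact fun hm => h2.2 (M.subset_closure _ ((Finset.coe_subset.2 hIF).trans hF) (Finset.mem_coe.2 hm))
      have hxI' : z'.2 ∉ z'.1 := by
        have h := hz'.1
        rw [hS, Finset.mem_sigma] at h
        have h2 := h.2
        unfold extF at h2
        rw [Finset.mem_filter] at h2
        obtain ⟨hIF, -, -⟩ := mem_indepF.1 h.1
        exact fun hm => h2.2 (M.subset_closure _ ((Finset.coe_subset.2 hIF).trans hF) (Finset.mem_coe.2 hm))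
      have hx : z.2 = z'.2 := hzz'
      have hI : z.1 = z'.1 := by
        have e1 : z.1 = J.erase z.2 := by rw [← hz.2, Finset.erase_insert hxI]
        have e2 : z'.1 = J.erase z'.2 := by rw [← hz'.2, Finset.erase_insert hxI']
        rw [e1, e2, hx]
      exact Sigma.ext hI (heq_of_eq hx)
  calc (indepF M F i).card * max (F.card - f) 1 ≤ S.card := hcardS
    _ ≤ (i + 1) * (indepF M F (i + 1)).card :=
        Finset.card_le_mul_card_image_of_maps_to hmaps (i + 1) hfib

open scoped Classical in
/-- **The greedy count**: `∏_{k < i} max(|F| − f k, 1) ≤ i! · #indepF F i` for `i ≤ q = r(F)`. -/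
theorem factorial_mul_card_indepF_ge [M.Finite] (F : Finset α) (hF : (F : Set α) ⊆ M.E) (q : ℕ)
    (hFq : M.eRk (F : Set α) = q) (f : ℕ → ℕ) (hf : ∀ i < q, ∀ X ⊆ M.E, M.eRk X ≤ i → X.ncard ≤ f i) :
    ∀ i ≤ q, ∏ k ∈ Finset.range i, max (F.card - f k) 1 ≤ i.factorial * (indepF M F i).card := by
  intro i
  induction i with
  | zero =>
    intro _
    rw [Finset.prod_range_zero, Nat.factorial_zero, card_indepF_zero]
    omega
  | succ i ih =>
    intro hi
    have hlt : i < q := by omega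
    have h1 := ih hlt.le
    have h2 := mul_card_indepF_succ_ge F hF q i hlt hFq (f i) (hf i hlt)
    rw [Finset.prod_range_succ, Nat.factorial_succ]
    calc (∏ k ∈ Finset.range i, max (F.card - f k) 1) * max (F.card - f i) 1
        ≤ (i.factorial * (indepF M F i).card) * max (F.card - f i) 1 := Nat.mul_le_mul_right _ h1
      _ = i.factorial * ((indepF M F i).card * max (F.card - f i) 1) := by ring
      _ ≤ i.factorial * ((i + 1) * (indepF M F (i + 1)).card) := Nat.mul_le_mul_left _ h2
      _ = (i + 1) * i.factorial * (indepF M F (i + 1)).card := by ring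

end Matroid

end PercRepro
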